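import Literature.MathematicalPhysics.QuantumFieldTheory.ContinuumLimits
import HarnessLib

/-!
# Barrier: triviality of scalar `φ⁴` / Ising scaling limits in `d ≥ 4`

Barrier catalogue `Literature/Barriers/QuantumFields/` (D-0021), summit `QuantumFields`
(conjuncts `YangMills`, `QCD`). This file records the **triviality barrier**: the theorems of
Aizenman (1982) and Fröhlich (1982) for `d ≥ 5` and of Aizenman–Duminil-Copin (2021) for the
marginal dimension `d = 4`, which say that every scaling limit of nearest-neighbour ferromagnetic
`φ⁴` / Ising lattice fields taken at or from the high-temperature side of the critical point,
with non-singular two-point function, is a (generalised) Gaussian field — i.e. the lattice route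
that produced `φ⁴₂` and `φ⁴₃` yields only free fields in four dimensions.

The mathematical statements are already in the tree as the named facts
`Literature.MathematicalPhysics.QuantumFieldTheory.phi44_triviality`, `Literature.MathematicalPhysics.QuantumFieldTheory.ising4_triviality` and
`Literature.MathematicalPhysics.QuantumFieldTheory.phi4_highDim_triviality`
(`Literature/MathematicalPhysics/QuantumFieldTheory/ContinuumLimits.lean`, item
constructive-qft.S24), so this file does **not** restate them: the barrier declarations below
are definitional aliases of those facts (unfolding lemmas `…_iff`), carrying the structured
barrier block (`ScalarPhi4Triviality`, an alias of `phi44_triviality`), plus the technique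
class as an explicit definition: `IsPhi44LatticeScalingLimit μ` ("`μ` is reachable by the lattice
`φ⁴₄` construction of ADC Def. 1.1 / the tree's S24 transcription, restated 2026-08-15 in the
printed regime: thermodynamic limit first, scaling window `L ≤ M ξ`"), with the proved
reformulation `scalarPhi4Triviality_iff_forall : ScalarPhi4Triviality ↔ ∀ μ,
IsPhi44LatticeScalingLimit μ → IsGaussianField μ`. One catalogue entry per file: the Ising₄ and
`d ≥ 5` statements are only *named* in the block (tree facts `ising4_triviality`,
`phi4_highDim_triviality`), not re-vendored.

## What the sources print

* Aizenman–Duminil-Copin, Ann. Math. 194 (2021), Thm 1.2 ("Gaussianity of `Φ⁴₄`"; numbering of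
  arXiv:1912.07973 and of the June 2020 preprint): for `d = 4`, any random field reachable as a
  scaling limit (Def. 1.1: `T_{f,L}(φ) = Σ_L^{-1/2} ∑ₓ f(x/L) φₓ`, double limit `L → ∞`,
  `R/L → ∞`, subsequences allowed) of the n.n.f. models (1.12) with a-priori measure
  `e^{-λφ⁴ + bφ²} dφ` (Ising included as the `λ → ∞` limit, §1.3) at `β ≤ β_c`, and satisfying
  `S₂(x,y) → 0` as `|x − y| → ∞`, is a generalised Gaussian process. Mechanism: Thm 1.3 (tree
  diagram bound improved by the bubble-diagram factor `B_L(β)^{-c}`) and Prop 1.4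
  (characteristic-function bound `≤ C ‖f‖_∞⁴ r_f¹² z⁴ / (log L)^c`).
* ibid. §1.1: "the progression of constructive results was halted when it was proved that for
  dimensions `d > 4` the attempt to construct `Φ⁴_d` with `lim S₂(x,y) = 0` by the method outlined
  above (in essence: taking the scaling limit of the lattice models at `β ≤ β_c`) yields only
  Gaussian fields [Aiz82, Fro82]"; and "(Here we do not discuss gauge field theories, cf. [JW])."
* Callaway, Phys. Rep. 167 (1988) §2.3 (review): "one- and two-component pure `φ⁴` field
  theories in `d = 4`, constructed as a scaling limit of ferromagnetic lattice field theories, are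
  trivial unless they are asymptotically free" (heuristic summary of the pre-2021 partial results).

## References

* M. Aizenman, H. Duminil-Copin, *Marginal triviality of the scaling limits of critical 4D Ising
  and `φ⁴₄` models*, Ann. Math. 194 (2021) 163–235, arXiv:1912.07973 — Def. 1.1, Thm 1.2,
  Thm 1.3, Prop 1.4, §1.1, §1.3.
* M. Aizenman, *Geometric analysis of `φ⁴` fields and Ising models I, II*, CMP 86 (1982) 1–48
  (paywalled here; statement taken from ADC 2021 §1.1 and Callaway 1988 §2.3).
* J. Fröhlich, *On the triviality of `λφ⁴_d` theories and the approach to the critical point in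
  `d ≥ 4` dimensions*, Nucl. Phys. B 200 (1982) 281–296 (idem).
* K. Gawędzki, A. Kupiainen, *Non-trivial continuum limit of a `φ⁴₄` model with negative coupling
  constant*, Nucl. Phys. B 257 (1985) 474–504 (asymptotically free evasion).
* D. J. E. Callaway, *Triviality pursuit*, Phys. Rep. 167 (1988) 241–320, §2.
-/

noncomputable section

open scoped SchwartzMap
open MeasureTheory Filter Topology
open Literature.MathematicalPhysics.QuantumLattice
open Literature.Probability.LatticeModels
open Literature.Probability.LatticeModels (box)

namespace Literature.Barriers.QuantumFields

/-! ### The technique class (explicit definition) -/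

/-- **Technique class "reachable by the lattice `φ⁴₄` construction"** (Aizenman–Duminil-Copin 2021,
Def. 1.1 and (1.12), in the tree's S24 transcription as restated on 2026-08-15 in the printed
regime): the random field law `μ` on `𝒮'(ℝ⁴)` (`FieldConfig`) is a scaling limit in law, as
`δ → 0⁺`, of laws `ν_δ` which are themselves, for every mesh `δ > 0`, the thermodynamic limits in
law (box `R → ∞` first — Def. 1.1: `lim_{L → ∞} lim_{R/L → ∞}`) of the smeared, renormalised
nearest-neighbour lattice `φ⁴` field `Φ_{δ,R}(f) = ρ(δ) δ⁴ ∑_{x ∈ box 4 R} f(δx) φₓ` under the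
free-boundary box measures — single-site potential `g φ⁴ + κ φ²` with `g > 0`, couplings
`0 ≤ J(δ) ≤ J_c(g, κ)` (at or from the high-temperature side of criticality) inside the scaling
window of ADC Prop. 7.2 (`J(δ) = J_c`, or `0 < J(δ)` and `ξ(J(δ))⁻¹ ≤ M δ`, i.e. `L = δ⁻¹ ≤ M ξ`),
any field renormalisation `ρ(δ)` — and has bounded (`≤ C‖x−y‖⁻²`) non-degenerate two-point
function (`HasBoundedNondegenerateTwoPoint`, the tree's rendering of ADC's non-singularity
condition (1.10)/(1.11)). These are exactly the hypotheses of
`Literature.MathematicalPhysics.QuantumFieldTheory.phi44_triviality`, packaged as a predicate on `μ`.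
[cite: AizenmanDuminilCopinAnnals2021, Def. 1.1, (1.12), Prop. 7.2 (window L ≤ ξ(ρ,β))] -/
def IsPhi44LatticeScalingLimit (μ : Measure (FieldConfig (EuclideanSpace ℝ (Fin 4)))) : Prop :=
  ∃ (g κ : ℝ) (J : ℝ → ℝ) (ρ : ℝ → ℝ) (ν : ℝ → Measure (FieldConfig (EuclideanSpace ℝ (Fin 4)))),
    0 < g ∧
    (∀ δ, 0 < δ → 0 ≤ J δ ∧ J δ ≤ phi4CriticalJ 4 g κ) ∧
    (∃ M : ℝ, ∀ᶠ δ in 𝓝[>] (0 : ℝ), J δ = phi4CriticalJ 4 g κ ∨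
        (0 < J δ ∧ invCorrLength (phi4TwoPoint 4 g κ (J δ)) ≤ M * δ)) ∧
    (∀ δ, 0 < δ → TendstoInLaw (fun R : ℕ =>
        latticeFieldLaw (phi4BoxMeasure 4 R g κ (J δ)) (box 4 R) δ (ρ δ)) atTop (ν δ)) ∧
    TendstoInLaw ν (𝓝[>] 0) μ ∧
    HasBoundedNondegenerateTwoPoint μ

/-! ### The barrier -/

/-- **Barrier (triviality of `φ⁴₄` scaling limits; Aizenman–Duminil-Copin 2021, Thm 1.2).**
The tree fact `Literature.MathematicalPhysics.QuantumFieldTheory.phi44_triviality` (as restated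
2026-08-15 in the printed regime): for the nearest-neighbour lattice `φ⁴` model on `ℤ⁴`
(`g φ⁴ + κ φ²`, `g > 0`), couplings `0 ≤ J(δ) ≤ J_c` inside the scaling window `δ⁻¹ ≤ M ξ(J(δ))`
(or `J(δ) = J_c`), any field renormalisation, thermodynamic limit of the free-boundary box states
taken first (ADC Def. 1.1), every scaling limit in law of the smeared field with bounded
(`≤ C ‖x−y‖⁻²`) non-degenerate two-point function is a centred Gaussian field.

technique_class: lattice-scaling-limit, scalar-lattice-regularisation, phi4-lattice-approximation, ising-type-approximation
blocks: constructing a NON-Gaussian `d = 4` Euclidean field (hence any Wightman theory via OS) as a subsequential scaling limit of nearest-neighbour ferromagnetic `φ⁴`/Ising/Griffiths–Simon-class lattice fields taken at `β ≤ β_c` with non-singular two-point function (ADC 2021 Def. 1.1, Thm 1.2) — the scalar analogue of the lattice route to `YangMills`; the same holds for the n.n. Ising model on `ℤ⁴` at `β ≤ β_c` (tree fact `Literature.MathematicalPhysics.QuantumFieldTheory.ising4_triviality`; ADC Thm 1.2 with §1.3, Ising as the `λ → ∞` limit of the a-priori measure) and for lattice `φ⁴_d`, `d ≥ 5` (tree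 fact `Literature.MathematicalPhysics.QuantumFieldTheory.phi4_highDim_triviality`; [cite: AizenmanCMP1982, Thm 1 and §7] [cite: FrohlichTrivialityNPB1982, main theorem (d ≥ 5), as quoted in AizenmanDuminilCopinAnnals2021 §1.1]).
because: in `d = 4` the Ursell function obeys the tree-diagram bound improved by the bubble-diagram factor, `|U₄(x,y,z,t)| ≤ C B_L(β)^{-c} ∑_u ⟨σ_uσ_x⟩⟨σ_uσ_y⟩⟨σ_uσ_z⟩⟨σ_uσ_t⟩` for `β ≤ β_c`, `L ≤ ξ(β)` and `x, y, z, t` at mutual distance larger than `L` (ADC 2021 Thm 1.3, via random currents and a multi-scale intersection argument), and the characteristic-function estimate `|⟨exp(z T_{f,L} − z²⟨T_{f,L}²⟩/2)⟩ − 1| ≤ C ‖f‖_∞⁴ r_f¹² z⁴ (log L)^{-c}` for `β ≤ β_c`, `L ≤ ξ(β)` (Prop 1.4) forces every limit to be Gaussian; for `d > 4` the unimproved tree-diagram bound with the infrared bound `⟨σ₀σ_x⟩ ≤ C|x|^{2−d}` indicates `|U₄|/S₄ = O(L^{4−d})` (heuristic dimension count of ADC 2021 §1.3 — "Up to numerous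 technical details this is the essence of the argument presented in [Aiz82, Fro82]", where it is made rigorous). [cite: AizenmanDuminilCopinAnnals2021, Thm 1.2–1.3, Prop 1.4, §1.1, §1.3]
evasions_known: (a) asymptotic freedom — Gawędzki–Kupiainen construct a non-trivial continuum limit of a `φ⁴₄` model with NEGATIVE coupling constant, an ultraviolet asymptotically free model [cite: GawedzkiKupiainenNegCoupling1985, title/abstract], and Callaway's review summarises the random-walk results as "trivial unless they are asymptotically free" [cite: CallawayPhysRep1988, §2.3 (p. 251)]; (b) coupling to gauge fields — "the coupled gauge–Higgs system may be nontrivial even though the pure scalar theory is trivial" [cite: CallawayPhysRep1988, §1 (p. 248) and §5.5.2]; (c) dimension — for `d = 2, 3` the same lattice construction gives non-Gaussian `φ⁴₂`, `φ⁴₃` (tree facts `Literature.MathematicalPhysics.QuantumFieldTheory.phi42_exists`, `phi43_exists`; ADC 2021 §1.1 [BryFroSpe82, GliJaf73]).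
scope_caveats: (i) as FORMALISED the barrier is narrower than printed on two axes: `phi44_triviality` assumes `HasBoundedNondegenerateTwoPoint` (a two-point density with `|S₂| ≤ C‖x−y‖⁻²` and `L²` evaluations) whereas ADC Thm 1.2 assumes only (1.10) `lim_{|x−y|→∞} S₂ = 0` with the `Σ_L^{-1/2}` normalisation of Def. 1.1, and it keeps to the scaling window `L ≤ M ξ(ρ,β)` of Prop. 7.2 (the quantitative input printed for the infinite-volume state), so couplings with `δ⁻¹ ≫ ξ(J(δ))` — where the limit is white noise (ADC §1.2 fn. 1) and the two-point hypothesis is expected to fail — and free-boundary boxes in a joint limit `δ L(δ) → ∞` are not covered by the Lean statement (the 2026-08-15 restatement dropped them as unprinted); (ii) only the single-site measures `e^{-gφ⁴-κφ²}dφ` (free b.c. boxes, thermodynamic limit first) on `ℤ⁴`, not the full Griffiths–Simon class of ADC §1.3/§7 — in particular the token `ising-type-approximation` is covered only via the tree fact `Literature.MathematicalPhysics.QuantumFieldTheory.ising4_triviality` named in `blocks:`, not by the Lean class `IsPhi44LatticeScalingLimit` / the decl `ScalarPhi4Triviality`; (iii) `J ≤ J_c` / `β ≤ β_c` only — limits taken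 from the low-temperature side are not covered; (iv) gauge theories, fermions, multi-component fields and non-lattice cutoffs are outside the printed statement ("Here we do not discuss gauge field theories (cf. [JW])", ADC §1.1) — for `YangMills` this is an ANALOGUE barrier; (v) "trivial" means Gaussian: the covariance of the limit is not identified (ADC, remark after Thm 1.2); (vi) the `d ≥ 5` sources (Aizenman 1982, Fröhlich 1982) were not consulted directly (paywalled, acq-00013, acq-00337) — statement as quoted by ADC 2021 §1.1 and the accepted tree fact.
status: established (Ann. Math. 194 (2021) 163–235; one-page corrigendum ibid. 199 (2024) 479 recorded in the bib entry, not consulted here)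

[cite: AizenmanDuminilCopinAnnals2021, Thm 1.2 (Gaussianity of Φ⁴₄; arXiv:1912.07973 numbering)] -/
def ScalarPhi4Triviality : Prop :=
  Literature.MathematicalPhysics.QuantumFieldTheory.phi44_triviality

/-- Unfolding: the barrier is definitionally the tree fact `phi44_triviality`. [folklore] -/
theorem scalarPhi4Triviality_iff :
    ScalarPhi4Triviality ↔ Literature.MathematicalPhysics.QuantumFieldTheory.phi44_triviality :=
  Iff.rfl

/-- **The barrier over its technique class**: `ScalarPhi4Triviality` says exactly that every `μ`
reachable by the lattice `φ⁴₄` construction (`IsPhi44LatticeScalingLimit μ`) is a centred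
Gaussian field — no non-Gaussian `d = 4` theory is reachable this way. (Currying of the tree
fact; proved.) [folklore] -/
theorem scalarPhi4Triviality_iff_forall :
    ScalarPhi4Triviality ↔
      ∀ μ : Measure (FieldConfig (EuclideanSpace ℝ (Fin 4))),
        IsPhi44LatticeScalingLimit μ → IsGaussianField μ := by
  constructor
  · rintro h μ ⟨g, κ, J, ρ, ν, hg, hJ, hW, hν, hlim, h2⟩
    exact h g κ hg J ρ ν μ hJ hW hν hlim h2
  · intro h g κ hg J ρ ν μ hJ hW hν hlim h2
    exact h μ ⟨g, κ, J, ρ, ν, hg, hJ, hW, hν, hlim, h2⟩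

/-- Contrapositive form used by planners: under the barrier, a NON-Gaussian field law is not
reachable by the lattice `φ⁴₄` construction. [folklore] -/
theorem not_isPhi44LatticeScalingLimit_of_not_gaussian (h : ScalarPhi4Triviality)
    {μ : Measure (FieldConfig (EuclideanSpace ℝ (Fin 4)))} (hμ : ¬ IsGaussianField μ) :
    ¬ IsPhi44LatticeScalingLimit μ :=
  fun hreach => hμ (scalarPhi4Triviality_iff_forall.1 h μ hreach)

end Literature.Barriers.QuantumFields

end
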